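import Summits.AtomisticToContinuum.HydrodynamicLimit.Theorems.BoxDissipativeWeakStrongFluxClosureEntKineticOfRelEntropy
import Summits.AtomisticToContinuum.HydrodynamicLimit.Theorems.BoxDissipativeWeakStrongFluxClosureEntExpMomentAssembly
import Summits.AtomisticToContinuum.HydrodynamicLimit.Theorems.BoxDissipativeWeakStrongFluxClosureEntBoxExpMoment
import Summits.AtomisticToContinuum.HydrodynamicLimit.Theorems.BoxDissipativeWeakStrongFluxClosureEntOneSiteShifted
import HarnessLib

/-!
# Crux `FluxClosure` (stmt-AtomisticToContinuum-9902, route BoxDissipativeWeakStrong), line `registered`: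
# kinetic isotropy from Yau-type relative-entropy local equilibrium (headline of the entropy line for stub K)

Support file (`--supports stmt-AtomisticToContinuum-9902`) of the lead prover. The open stub K (`stub_kineticIsotropy`)
of the crux skeleton says that the traceless box peculiar velocity covariance of the cube-kernel box fields, tested against
`∇w` and integrated in space–time along the deterministic hard-sphere flow, tends to `0` in `L¹(P_N)` at every kinetic window.
This file assembles the c3 "entropy line" into two theorems:

* `kinEntry_expMoment_localGibbs` (registered sub-goal H1) — the SPEED-`(N+1)` EXPONENTIAL MOMENT of the static
  K-integrand `X_G(z) = ∫ₓ Σᵢⱼ Aᵢⱼ(z, x) Gᵢⱼ(x) dx` under an ARBITRARY local Gibbs measure with continuous profiles bounded by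
  `θ_M` and `(δu, δθ)`-local at window `l`:
  `∫ exp(γ (N+1) |X_G|) d(localGibbsMeasure σ a₀ u₀ θ₀ N) ≤ exp((N+1)(C (γB)² + γB·C(δθ + δu²) + C ((N+1)l³)⁻¹))` for
  `0 < γ`, `γB ≤ γ₀` (`C, γ₀` depend on `θ_M` only). It is the composition of the three landed wave-3 pieces: the one-site
  shifted-reference Gaussian exponential moment `FluxClosureEnt.oneSite_lintegral_exp_shiftedQuad_le` (H1a1), the box-level
  bound given the positions `FluxClosureEnt.box_lintegral_exp_kinEntry_le` (H1a2: pointwise traceless inequality of E6 at the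
  box reference, AM–GM over its twelve terms, conditional independence of the particles, χ²-type moment of the momentum
  fluctuation) and the assembly `FluxClosureEnt.kinEntry_expMoment_localGibbs_of_box` (H1b: Jensen over the shift average of
  the torus integral, disjoint lattice cubes ⇒ independence of the block functionals under the product velocity law,
  disintegration of the local Gibbs measure).
* `kineticIsotropy_of_entropicLE` (registered headline) — STUB K's CONCLUSION, for every flow family, every kinetic window
  (`ℓ_N → 0`, `(N+1)ℓ_N³ → ∞`), every horizon `τ < T` and every smooth `w`, FOLLOWS from RELATIVE-ENTROPY LOCAL EQUILIBRIUM
  WITH FREE PARAMETERS: if there are jointly continuous parameter profiles `(a_t, u_t, θ_t)` on `[0,τ] × 𝕋³` (`a, θ > 0`) with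
  `sup_{t ≤ τ} H((Φ_t)_* P_N ‖ localGibbsMeasure σ a_t u_t θ_t N) ≤ (N+1) h_N`, `h_N → 0`, then the kinetic deviation
  `KinDev_N → 0` in `L¹(P_N)`. It is `FluxClosureEnt.kineticIsotropy_of_relEntropy` (H2: Yau's entropy inequality slice by
  slice in time, `NearConstantShortTimeHL.integral_comp_flow_le_klDiv_add_log_of_nonneg`) fed with H1.

Meaning for the crux: stub K is AT MOST as strong as the standard local-equilibrium hypothesis of the relative entropy method
(Yau 1991; Olla–Varadhan–Yau 1993 prove exactly such an entropy bound for Hamiltonian dynamics WITH noise) — with the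
parameters left free, i.e. WITHOUT any identification of the hydrodynamic equations. Together with the static theorems
(G2 `FluxClosureEq.G2.kineticIsotropy_static_localGibbs`: K holds for every local Gibbs STATE; E7: K holds at all times in
global equilibrium) this pins the open content of K as the propagation of local equilibrium, in entropy OR flux sense,
along the deterministic flow. No definitions.

References: H.-T. Yau, Lett. Math. Phys. 22 (1991) 63–80; S. Olla, S. R. S. Varadhan, H.-T. Yau, Comm. Math. Phys. 155
(1993) 523–560, §3; C. Kipnis, C. Landim, *Scaling Limits of Interacting Particle Systems* (1999), App. 1 §8, Ch. 6;
H. Spohn, *Large Scale Dynamics of Interacting Particles* (1991), Part I §2.3, §3.3.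
-/

noncomputable section

namespace Summit.AtomisticToContinuum.HydrodynamicLimit.Theorems
namespace FluxClosureEnt

open scoped BigOperators Topology Classical MeasureTheory ProbabilityTheory InnerProductSpace ENNReal
open Filter Set Function MeasureTheory ProbabilityTheory
open Literature.MathematicalPhysics.KineticTheory Literature.Analysis.FluidPDE Literature.Analysis.FunctionSpaces
open Summit.AtomisticToContinuum.HydrodynamicLimit.Theses.BoxDissipativeWeakStrong

/-- **Sub-goal H1 (speed-`(N+1)` exponential moment of the K-integrand under a general local Gibbs measure).** For every
temperature ceiling `θ_M > 0` there are `C ≥ 0` and `γ₀ > 0` such that for `σ ≤ 1/2`, continuous profiles `a₀ > 0`,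
`0 < θ₀ ≤ θ_M`, `u₀`, every `N`, window `0 < l ≤ 1` at which the cube kernel is `(δu, δθ)`-local for `(u₀, θ₀)`
(`0 ≤ δu ≤ 1`, `0 ≤ δθ`), every bounded measurable matrix field `|Gᵢⱼ| ≤ B` and every `0 < γ` with `γB ≤ γ₀`:
`∫ exp(γ(N+1)|X_G|) dLG ≤ exp((N+1)(C(γB)² + γB·C(δθ+δu²) + C((N+1)l³)⁻¹))`. Proof: H1b ∘ H1a2 ∘ H1a1. -/
theorem kinEntry_expMoment_localGibbs : ∀ θM : ℝ, 0 < θM → ∃ C : ℝ, 0 ≤ C ∧ ∃ γ₀ : ℝ, 0 < γ₀ ∧ ∀ (σ : ℝ) (a₀ θ₀ : T3 → ℝ) (u₀ : T3 → V3), σ ≤ 1 / 2 → Continuous a₀ → Continuous θ₀ → Continuous u₀ → (∀ x, 0 < a₀ x) → (∀ x, 0 < θ₀ x) → (∀ x, θ₀ x ≤ θM) → ∀ (N : ℕ) (l δu δθ : ℝ), 0 < l → l ≤ 1 → 0 ≤ δu → δu ≤ 1 → 0 ≤ δθ → (∀ x y : T3, indicator {y' : T3 | ∀ i, ‖y' i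 - x i‖ < l / 2} (fun _ => (l ^ 3)⁻¹) y ≠ 0 → ‖u₀ y - u₀ x‖ ≤ δu ∧ |θ₀ y - θ₀ x| ≤ δθ) → ∀ (G : T3 → Fin 3 → Fin 3 → ℝ) (B : ℝ), (∀ i j, Measurable fun x => G x i j) → (∀ x i j, |G x i j| ≤ B) → ∀ γ : ℝ, 0 < γ → γ * B ≤ γ₀ → let K := fun (x y : T3) => indicator {y' : T3 | ∀ i, ‖y' i - x i‖ < l / 2} (fun _ => (l ^ 3)⁻¹) y; let Dn := fun (z : Config (N + 1) (Fin 3) T3) (x : T3) => empiricalDensityField z (K x); let Mm := fun (z : Config (N + 1) (Fin 3) T3) (x : T3) => empiricalMomentumField z (K x); let En := fun (z : Config (N + 1) (Fin 3) T3) (x : T3) => empiricalEnergyField z (K x); let Sk := fun (z : Config (N + 1) (Fin 3) T3) (x : T3) (i j : Fin 3) => ∫ y, K x y.1 * (y.2 i * y.2 j) ∂(empiricalMeasure z); let Th := fun (r : ℝ) (m : V3) (E : ℝ) => 2 / 3 * (E / r - ‖m‖ ^ 2 / (2 * r ^ 2)); ∫⁻ z, ENNReal.ofReal (Real.exp (γ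 * ((N : ℝ) + 1) * |∫ x, ∑ i, ∑ j, (Sk z x i j - Mm z x i * Mm z x j / Dn z x - (if i = j then Dn z x * Th (Dn z x) (Mm z x) (En z x) else 0)) * G x i j|)) ∂(localGibbsMeasure σ a₀ u₀ θ₀ N) ≤ ENNReal.ofReal (Real.exp (((N : ℝ) + 1) * (C * (γ * B) ^ 2 + γ * B * (C * (δθ + δu ^ 2)) + C * (((N : ℝ) + 1) * l ^ 3)⁻¹))) :=
  kinEntry_expMoment_localGibbs_of_box (box_lintegral_exp_kinEntry_le oneSite_lintegral_exp_shiftedQuad_le)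

/-- **Kinetic isotropy from relative-entropy local equilibrium with free parameters (headline of the entropy line for
stub K of crux `FluxClosure`).** For `0 < σ ≤ 1/2`, continuous profiles `a₀, θ₀ > 0`, `u₀`, every hard-sphere flow family
`Φ`, every kinetic window `ℓ` (`0 < ℓ_N ≤ 1`, `ℓ_N → 0`, `ℓ_N³(N+1) → ∞`), every `τ ∈ [0, T)`, every `w` smooth on
`[0,T) × 𝕋³` and every jointly continuous reference parameter family `(a_t, u_t, θ_t)` (`a, θ > 0`): IF the law of the
deterministically evolved local Gibbs datum stays `o(N+1)`-close in relative entropy to the local Gibbs measures of the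
reference parameters, uniformly on `[0, τ]`, THEN the kinetic deviation of the crux (the functional of `stub_kineticIsotropy`,
verbatim) tends to `0` in `L¹(P_N)`. Proof: `kineticIsotropy_of_relEntropy` (H2) applied to `kinEntry_expMoment_localGibbs` (H1). -/
theorem kineticIsotropy_of_entropicLE : ∀ (σ : ℝ) (a₀ θ₀ : T3 → ℝ) (u₀ : T3 → V3), 0 < σ → σ ≤ 1 / 2 → Continuous a₀ → Continuous θ₀ → Continuous u₀ → (∀ x, 0 < a₀ x) → (∀ x, 0 < θ₀ x) → ∀ (Φ : (N : ℕ) → HardSphereFlow (Torus.geometry (Fin 3)) (hsDiameter σ N) (N + 1)) (ℓ : ℕ → ℝ), (∀ N, 0 < ℓ N ∧ ℓ N ≤ 1) → Tendsto ℓ atTop (𝓝 0) → Tendsto (fun N : ℕ => ℓ N ^ 3 * ((N : ℝ) + 1)) atTop atTop → ∀ (T τ : ℝ), τ ∈ Ico 0 T → ∀ (w : ℝ → T3 → V3), Torus.IsSmoothSpaceTimeOn (Ico 0 T) w → ∀ (a θ : ℝ → T3 → ℝ) (u : ℝ → T3 → V3), Continuous (fun p : ℝ × T3 => a p.1 p.2)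 → Continuous (fun p : ℝ × T3 => θ p.1 p.2) → Continuous (fun p : ℝ × T3 => u p.1 p.2) → (∀ t x, 0 < a t x) → (∀ t x, 0 < θ t x) → (∃ h : ℕ → ℝ, Tendsto h atTop (𝓝 0) ∧ ∀ (N : ℕ) (t : ℝ), t ∈ Icc 0 τ → InformationTheory.klDiv ((Φ N).lawAt (localGibbsLaw σ a₀ u₀ θ₀ N (Φ N)) t) (localGibbsMeasure σ (a t) (u t) (θ t) N) ≤ ENNReal.ofReal (((N : ℝ) + 1) * h N)) → let K := fun (l : ℝ) (x y : T3) => indicator {y' : T3 | ∀ i, ‖y' i - x i‖ < l / 2} (fun _ => (l ^ 3)⁻¹) y; let Dn := fun N t z x => empiricalDensityField ((Φ N).flow t z) (K (ℓ N) x); let Mm := fun N t z x => empiricalMomentumField ((Φ N).flow t z) (K (ℓ N) x); let En := fun N t z x => empiricalEnergyField ((Φ N).flow t z) (K (ℓ N) x); let Sk := fun N t z x (i j : Fin 3) => ∫ y, K (ℓ N) x y.1 * (y.2 i * y.2 j) ∂(empiricalMeasure ((Φ N).flow t z)); let Th := fun (r : ℝ) (m : V3) (E : ℝ) => 2 / 3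 * (E / r - ‖m‖ ^ 2 / (2 * r ^ 2)); Tendsto (fun N : ℕ => ∫⁻ z, ENNReal.ofReal (|∫ t in Ioc 0 τ, ∫ x, ∑ i, ∑ j, (Sk N t z x i j - Mm N t z x i * Mm N t z x j / Dn N t z x - (if i = j then Dn N t z x * Th (Dn N t z x) (Mm N t z x) (En N t z x) else 0)) * Torus.partialDeriv j (fun y => w t y i) x|) ∂(localGibbsLaw σ a₀ u₀ θ₀ N (Φ N))) atTop (𝓝 0) :=
  kineticIsotropy_of_relEntropy kinEntry_expMoment_localGibbs

end FluxClosureEnt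
end Summit.AtomisticToContinuum.HydrodynamicLimit.Theorems

end
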